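import Literature.Analysis.Complex.SesquiHolomorphicPairing
import Literature.MathematicalPhysics.QuantumFieldTheory.OSHolomorphicVectors
import HarnessLib

/-!
# The generating function of the step (P_N) ⇒ (A_{N+1}) of OS II, with split independence

Topic `Literature/MathematicalPhysics/QuantumFieldTheory`; support file (everything proved, no
definitions, no named facts) for the discharge of (A1) `OS1975_exists_timeContinuation`.
Osterwalder–Schrader II (Comm. Math. Phys. 42 (1975)), Ch. V.2, p. 294: *"By (P_{M-1}) we can
define `S_k(θζ', x' + x + τ, ζ) = (Ψₙ(x', ζ'), e^{-τH} Ψₘ(x, ζ))` for `(x', ζ') ∈ D_n^{(M-1)}` and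
`(x, ζ) ∈ D_m^{(M-1)}`; this analytically extends `S_k`"*. Two things are implicit here: that the
right-hand side depends on `(x', x, τ)` only through `x' + x + τ`, and that the resulting function
of `(θζ', x' + x + τ, ζ)` is jointly holomorphic. This file proves both, abstractly:

* hypotheses: a complex Hilbert space `H`; an operator family `T τ` (`= e^{-τH}`) which is weakly
  holomorphic and bounded on `{Re τ > 0}`, satisfies the semigroup law
  `T (a + b) = T a ∘ T b` (`Re a, Re b ≥ 0`) and is symmetric at real times
  (`⟪T t u, v⟫ = ⟪u, T t v⟫`, `t > 0`) — all available for the OS semigroup of the tree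
  (`OSDistributionSpaceHolomorphicSemigroup(Law)`); two families `Ψ₁ x`, `Ψ₂ x` (`x > 0`) of
  holomorphic `H`-valued maps on open sets `U₁ ⊆ ℂ^{m₁}`, `U₂ ⊆ ℂ^{m₂}`, shifted by the semigroup,
  `T t (Ψᵢ x z) = Ψᵢ (x + t) z` (which follows from its real-point case,
  `clm_apply_eq_of_eq_on_reals`);
* `inner_semigroup_split_eq` — **split independence**: `⟪Ψ₁ x' w, T τ (Ψ₂ x z)⟫` equals the
  canonical expression `⟪Ψ₁ ε w, T (τ + (x' - ε) + (x - ε)) (Ψ₂ ε z)⟫` for any `0 < ε < x', x`;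
* `exists_generatingFunction` — **the generating function**: there is `G`, holomorphic on
  `{(w, ζ, z) | star w ∈ U₁, Re ζ > 0, z ∈ U₂}`, with
  `G (w, ζ, z) = ⟪Ψ₁ x' (star w), T τ (Ψ₂ x z)⟫` for *every* split `x' + x + τ = ζ`
  (`x', x > 0`, `Re τ ≥ 0`); holomorphy by `differentiableOn_inner_star_semigroup`
  (`SesquiHolomorphicPairing`) applied locally with a frozen split.

## References

* K. Osterwalder, R. Schrader, *Axioms for Euclidean Green's functions II*, Comm. Math. Phys. 42
  (1975) 281–305, Ch. V.2 p. 294 ((P_{M-1}) ⇒ (A_M)). [OsterwalderSchraderCMP1975]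
-/

noncomputable section

open Metric Set Filter Complex
open scoped Topology ComplexConjugate InnerProductSpace

namespace Literature.MathematicalPhysics.QuantumFieldTheory

open Literature.Analysis.Complex

variable {H : Type*} [NormedAddCommGroup H] [InnerProductSpace ℂ H]

/-! ### Shifts from real points -/

/-- **An operator identity between holomorphic vector maps propagates from the real points**:
if `A (Ψa η) = Ψb η` at the real points of an open preconnected `U ∋` a real point, then
`A (Ψa z) = Ψb z` on `U` (used for `e^{-tH} Ψ(x, ζ) = Ψ(x + t, ζ)`, OS II p. 294). [cite: OsterwalderSchraderCMP1975, Ch. V.2 p. 294] -/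
theorem clm_apply_eq_of_eq_on_reals {m : ℕ} {U : Set (Fin m → ℂ)} (hU : IsOpen U)
    (hUc : IsPreconnected U) {x₀ : Fin m → ℝ} (hx₀ : (fun i => (x₀ i : ℂ)) ∈ U)
    {Ψa Ψb : (Fin m → ℂ) → H} (ha : DifferentiableOn ℂ Ψa U) (hb : DifferentiableOn ℂ Ψb U)
    (A : H →L[ℂ] H)
    (h : ∀ η : Fin m → ℝ, (fun i => (η i : ℂ)) ∈ U → A (Ψa fun i => (η i : ℂ)) = Ψb fun i => (η i : ℂ)) :
    ∀ z ∈ U, A (Ψa z) = Ψb z := fun _ hz =>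
  eqOn_of_eqOn_reals_hilbert hU hUc (A.differentiable.comp_differentiableOn ha) hb hx₀ h hz

/-! ### Split independence -/

section Split

variable {T : ℂ → H →L[ℂ] H} {m₁ m₂ : ℕ} {U₁ : Set (Fin m₁ → ℂ)} {U₂ : Set (Fin m₂ → ℂ)}
  {Ψ₁ : ℝ → (Fin m₁ → ℂ) → H} {Ψ₂ : ℝ → (Fin m₂ → ℂ) → H}

/-- **Split independence, canonical form**: for `0 < ε < x', x` and `Re τ ≥ 0`,
`⟪Ψ₁ x' w, T τ (Ψ₂ x z)⟫ = ⟪Ψ₁ ε w, T (τ + (x' - ε) + (x - ε)) (Ψ₂ ε z)⟫ (semigroup law,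
symmetry at real times, and the shift property of the families). [cite: OsterwalderSchraderCMP1975, Ch. V.2 p. 294] -/
theorem inner_semigroup_split_eq
    (hlaw : ∀ a b : ℂ, 0 ≤ a.re → 0 ≤ b.re → T (a + b) = (T a).comp (T b))
    (hsymm : ∀ t : ℝ, 0 < t → ∀ u v : H, ⟪T t u, v⟫_ℂ = ⟪u, T t v⟫_ℂ)
    (hsh₁ : ∀ x t : ℝ, 0 < x → 0 < t → ∀ w ∈ U₁, T t (Ψ₁ x w) = Ψ₁ (x + t) w)
    (hsh₂ : ∀ x t : ℝ, 0 < x → 0 < t → ∀ z ∈ U₂, T t (Ψ₂ x z) = Ψ₂ (x + t) z)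
    {w : Fin m₁ → ℂ} (hw : w ∈ U₁) {z : Fin m₂ → ℂ} (hz : z ∈ U₂) {x' x ε : ℝ} (hε : 0 < ε)
    (hεx' : ε < x') (hεx : ε < x) {τ : ℂ} (hτ : 0 ≤ τ.re) :
    ⟪Ψ₁ x' w, T τ (Ψ₂ x z)⟫_ℂ =
      ⟪Ψ₁ ε w, T (τ + ((x' - ε : ℝ) : ℂ) + ((x - ε : ℝ) : ℂ)) (Ψ₂ ε z)⟫_ℂ := by
  have ha : 0 < x' - ε := by linarith
  have hb : 0 < x - ε := by linarith
  have h1 : Ψ₁ x' w = T ((x' - ε : ℝ) : ℂ) (Ψ₁ ε w) := by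
    rw [hsh₁ ε (x' - ε) hε ha w hw, show ε + (x' - ε) = x' by ring]
  have h2 : Ψ₂ x z = T ((x - ε : ℝ) : ℂ) (Ψ₂ ε z) := by
    rw [hsh₂ ε (x - ε) hε hb z hz, show ε + (x - ε) = x by ring]
  have hare : 0 ≤ (((x' - ε : ℝ) : ℂ)).re := by simp [ha.le]
  have hbre : 0 ≤ (((x - ε : ℝ) : ℂ)).re := by simp [hb.le]
  rw [h1, h2, hsymm (x' - ε) ha]
  congr 1
  -- `T a (T τ (T b v)) = T (τ + a + b) v`
  have hτb : T (τ + ((x - ε : ℝ) : ℂ)) = (T τ).comp (T ((x - ε : ℝ) : ℂ)) := hlaw τ _ hτ hbre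
  have hall : T (τ + ((x' - ε : ℝ) : ℂ) + ((x - ε : ℝ) : ℂ)) =
      (T ((x' - ε : ℝ) : ℂ)).comp (T (τ + ((x - ε : ℝ) : ℂ))) := by
    rw [show τ + ((x' - ε : ℝ) : ℂ) + ((x - ε : ℝ) : ℂ) = ((x' - ε : ℝ) : ℂ) + (τ + ((x - ε : ℝ) : ℂ))
      by ring]
    exact hlaw _ _ hare (by simp only [Complex.add_re]; linarith [hbre])
  rw [hall, hτb]
  rfl

end Split

/-! ### The generating function -/

section Generating

variable [CompleteSpace H] {T : ℂ → H →L[ℂ] H} {m₁ m₂ : ℕ} {U₁ : Set (Fin m₁ → ℂ)}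
  {U₂ : Set (Fin m₂ → ℂ)} {Ψ₁ : ℝ → (Fin m₁ → ℂ) → H} {Ψ₂ : ℝ → (Fin m₂ → ℂ) → H}

/-- **The generating function of (P_N) ⇒ (A_{N+1})** (OS II p. 294, abstract form): under the
hypotheses of the module docstring there is `G`, holomorphic on
`{(w, ζ, z) | star w ∈ U₁, Re ζ > 0, z ∈ U₂}`, such that
`G (w, ζ, z) = ⟪Ψ₁ x' (star w), T τ (Ψ₂ x z)⟫` for every split `x' + x + τ = ζ` with
`x', x > 0`, `Re τ ≥ 0`. [cite: OsterwalderSchraderCMP1975, Ch. V.2 p. 294] -/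
theorem exists_generatingFunction
    (hTw : ∀ u v : H, DifferentiableOn ℂ (fun τ => ⟪u, T τ v⟫_ℂ) {τ : ℂ | 0 < τ.re})
    (hTb : ∃ C : ℝ, ∀ τ : ℂ, 0 < τ.re → ‖T τ‖ ≤ C)
    (hlaw : ∀ a b : ℂ, 0 ≤ a.re → 0 ≤ b.re → T (a + b) = (T a).comp (T b))
    (hsymm : ∀ t : ℝ, 0 < t → ∀ u v : H, ⟪T t u, v⟫_ℂ = ⟪u, T t v⟫_ℂ)
    (hU₁ : IsOpen U₁) (hU₂ : IsOpen U₂)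
    (hΨ₁ : ∀ x : ℝ, 0 < x → DifferentiableOn ℂ (Ψ₁ x) U₁)
    (hΨ₂ : ∀ x : ℝ, 0 < x → DifferentiableOn ℂ (Ψ₂ x) U₂)
    (hsh₁ : ∀ x t : ℝ, 0 < x → 0 < t → ∀ w ∈ U₁, T t (Ψ₁ x w) = Ψ₁ (x + t) w)
    (hsh₂ : ∀ x t : ℝ, 0 < x → 0 < t → ∀ z ∈ U₂, T t (Ψ₂ x z) = Ψ₂ (x + t) z) :
    ∃ G : (Fin m₁ → ℂ) × ℂ × (Fin m₂ → ℂ) → ℂ,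
      DifferentiableOn ℂ G {p | star p.1 ∈ U₁ ∧ 0 < p.2.1.re ∧ p.2.2 ∈ U₂} ∧
      ∀ (w : Fin m₁ → ℂ) (ζ : ℂ) (z : Fin m₂ → ℂ), star w ∈ U₁ → z ∈ U₂ →
        ∀ (x' x : ℝ) (τ : ℂ), 0 < x' → 0 < x → 0 ≤ τ.re → (x' : ℂ) + x + τ = ζ →
          G (w, ζ, z) = ⟪Ψ₁ x' (star w), T τ (Ψ₂ x z)⟫_ℂ := by
  -- the canonical definition: split `(Re ζ/4, Re ζ/4, ζ - Re ζ/2)`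
  set G : (Fin m₁ → ℂ) × ℂ × (Fin m₂ → ℂ) → ℂ := fun p =>
    ⟪Ψ₁ (p.2.1.re / 4) (star p.1), T (p.2.1 - ((p.2.1.re / 2 : ℝ) : ℂ)) (Ψ₂ (p.2.1.re / 4) p.2.2)⟫_ℂ
    with hG
  -- every admissible split gives the value of `G`
  have hsplit : ∀ (w : Fin m₁ → ℂ) (ζ : ℂ) (z : Fin m₂ → ℂ), star w ∈ U₁ → z ∈ U₂ →
      ∀ (x' x : ℝ) (τ : ℂ), 0 < x' → 0 < x → 0 ≤ τ.re → (x' : ℂ) + x + τ = ζ →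
        G (w, ζ, z) = ⟪Ψ₁ x' (star w), T τ (Ψ₂ x z)⟫_ℂ := by
    intro w ζ z hw hz x' x τ hx' hx hτ hsum
    have hζre : ζ.re = x' + x + τ.re := by
      rw [← hsum]; simp
    have hζpos : 0 < ζ.re := by rw [hζre]; linarith
    -- a common small `ε`
    set ε : ℝ := min (min x' x) (ζ.re / 4) / 2 with hε
    have hmin : 0 < min (min x' x) (ζ.re / 4) := lt_min (lt_min hx' hx) (by linarith)
    have hε0 : 0 < ε := by rw [hε]; linarith
    have hεx' : ε < x' := by
      have : min (min x' x) (ζ.re / 4) ≤ x' := (min_le_left _ _).trans (min_le_left _ _)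
      rw [hε]; linarith
    have hεx : ε < x := by
      have : min (min x' x) (ζ.re / 4) ≤ x := (min_le_left _ _).trans (min_le_right _ _)
      rw [hε]; linarith
    have hεζ : ε < ζ.re / 4 := by
      have : min (min x' x) (ζ.re / 4) ≤ ζ.re / 4 := min_le_right _ _
      rw [hε]; linarith
    -- both splits reduce to the canonical `ε`-split with total `ζ - 2ε`
    have hA := inner_semigroup_split_eq hlaw hsymm hsh₁ hsh₂ hw hz hε0 hεx' hεx hτ
    have hτ' : 0 ≤ (ζ - ((ζ.re / 2 : ℝ) : ℂ)).re := by
      simp only [Complex.sub_re, Complex.ofReal_re]; linarith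
    have hq' : 0 < ζ.re / 4 := by linarith
    have hB := inner_semigroup_split_eq hlaw hsymm hsh₁ hsh₂ hw hz hε0 (by linarith) (by linarith) hτ'
      (x' := ζ.re / 4) (x := ζ.re / 4)
    have e1 : τ + ((x' - ε : ℝ) : ℂ) + ((x - ε : ℝ) : ℂ) = ζ - 2 * (ε : ℂ) := by
      rw [← hsum]; push_cast; ring
    have e2 : ζ - ((ζ.re / 2 : ℝ) : ℂ) + ((ζ.re / 4 - ε : ℝ) : ℂ) + ((ζ.re / 4 - ε : ℝ) : ℂ) =
        ζ - 2 * (ε : ℂ) := by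
      push_cast; ring
    show ⟪Ψ₁ (ζ.re / 4) (star w), T (ζ - ((ζ.re / 2 : ℝ) : ℂ)) (Ψ₂ (ζ.re / 4) z)⟫_ℂ = _
    rw [hB, hA, e1, e2]
  refine ⟨G, ?_, hsplit⟩
  -- holomorphy: freeze the split near each point
  obtain ⟨C, hC⟩ := hTb
  intro p₀ hp₀
  obtain ⟨hw₀, hr₀, hz₀⟩ := hp₀
  set r₀ : ℝ := p₀.2.1.re with hr₀def
  set ε : ℝ := r₀ / 8 with hεdef
  have hε : 0 < ε := by rw [hεdef]; positivity
  -- the frozen expression and its holomorphy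
  set S' : Set ℂ := {τ | 2 * ε < τ.re} with hS'
  have hS'o : IsOpen S' := isOpen_lt continuous_const Complex.continuous_re
  set T' : ℂ → H →L[ℂ] H := fun τ => T (τ - 2 * (ε : ℂ)) with hT'
  have hT'w : ∀ u v : H, DifferentiableOn ℂ (fun τ => ⟪u, T' τ v⟫_ℂ) S' := by
    intro u v
    have h := (hTw u v).comp ((differentiable_id.sub_const (2 * (ε : ℂ))).differentiableOn)
      (fun τ (hτ : τ ∈ S') => by
        show 0 < (τ - 2 * (ε : ℂ)).re
        have : (τ - 2 * (ε : ℂ)).re = τ.re - 2 * ε := by simp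
        rw [this]; have := hτ; rw [hS'] at this; exact sub_pos.2 this)
    exact h
  have hT'b : ∃ C' : ℝ, ∀ τ ∈ S', ‖T' τ‖ ≤ C' := ⟨C, fun τ hτ => hC _ (by
      have : (τ - 2 * (ε : ℂ)).re = τ.re - 2 * ε := by simp
      show 0 < (τ - 2 * (ε : ℂ)).re
      rw [this]; have := hτ; rw [hS'] at this; exact sub_pos.2 this)⟩
  have hF := differentiableOn_inner_star_semigroup (m₂ := m₂) hS'o hT'w hT'b hU₁ (hΨ₁ ε hε) hU₂ (hΨ₂ ε hε)
  -- the set where the frozen split is admissible is an open neighbourhood of `p₀`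
  set W' : Set ((Fin m₁ → ℂ) × ℂ × (Fin m₂ → ℂ)) := {p | star p.1 ∈ U₁ ∧ p.2.1 ∈ S' ∧ p.2.2 ∈ U₂}
    with hW'
  have hW'o : IsOpen W' := by
    have hc : Continuous fun p : (Fin m₁ → ℂ) × ℂ × (Fin m₂ → ℂ) => (star p.1, p.2.1, p.2.2) :=
      (continuous_star.comp continuous_fst).prodMk
        ((continuous_fst.comp continuous_snd).prodMk (continuous_snd.comp continuous_snd))
    have : W' = (fun p : (Fin m₁ → ℂ) × ℂ × (Fin m₂ → ℂ) => (star p.1, p.2.1, p.2.2)) ⁻¹'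
        (U₁ ×ˢ S' ×ˢ U₂) := by
      ext p; simp [hW', Set.mem_prod]
    rw [this]
    exact (hU₁.prod (hS'o.prod hU₂)).preimage hc
  have hp₀W' : p₀ ∈ W' := ⟨hw₀, by show 2 * ε < p₀.2.1.re; rw [hεdef, hr₀def]; linarith, hz₀⟩
  -- on `W'`, `G` is the frozen expression
  have hagree : ∀ p ∈ W', G p = ⟪Ψ₁ ε (star p.1), T' p.2.1 (Ψ₂ ε p.2.2)⟫_ℂ := by
    rintro ⟨w, ζ, z⟩ ⟨hw, hζ, hz⟩
    have hζ' : 2 * ε < ζ.re := hζ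
    have h := hsplit w ζ z hw hz ε ε (ζ - 2 * (ε : ℂ)) hε hε
      (by have : (ζ - 2 * (ε : ℂ)).re = ζ.re - 2 * ε := by simp
          rw [this]; linarith) (by ring)
    simpa [hT'] using h
  have hd : DifferentiableAt ℂ (fun p : (Fin m₁ → ℂ) × ℂ × (Fin m₂ → ℂ) =>
      ⟪Ψ₁ ε (star p.1), T' p.2.1 (Ψ₂ ε p.2.2)⟫_ℂ) p₀ :=
    hF.differentiableAt (hW'o.mem_nhds hp₀W')
  have hev : G =ᶠ[𝓝 p₀] fun p => ⟪Ψ₁ ε (star p.1), T' p.2.1 (Ψ₂ ε p.2.2)⟫_ℂ := by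
    filter_upwards [hW'o.mem_nhds hp₀W'] with p hp using hagree p hp
  exact (hd.congr_of_eventuallyEq hev).differentiableWithinAt

end Generating

end Literature.MathematicalPhysics.QuantumFieldTheory
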